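import Literature.MathematicalPhysics.QuantumFieldTheory.Balaban1983to89.B11Ineq189Census

/-!
# `Balaban1983to89.B11Ineq189Transpose` — [Balaban1985Variational] p. 308, inequality (189): the TRANSPOSED families
# `δ𝔇*[𝔄]` (with `𝔇*`, `H*`) of the SHAPE-B rows of the (189) census (T1″, T2.3″, T2.4″, T3″, T4.2″, T5.B″) — how a
# majorant TRANSPOSES under a pairing, at which constant and at which RATE, and the six rows re-typed from the
# UNtransposed (primal) `δ𝔇`-family that the tree holds at concrete letters

statement-level skeleton of published theorems with citation tags; proofs where landed; nothing here is a claim about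
the Yang–Mills mass gap.

CITATION HEADER (lean-in-tree rule 2026-08-18).  Source under audit: T. Bałaban, *The variational problem and background
fields in renormalization group method for lattice gauge theories*, Commun. Math. Phys. **102**, 277–309 (1985)
[Balaban1985Variational] (cell paper B11; p. 308 (189), pp. 291–292 (85)–(96), p. 289 (73)); reference [3] of the paper
= [Balaban1984PropagatorsII] ((2.51)–(2.56) pp. 232–233, Lemma 2.1 p. 234).  The displays are quoted verbatim in
`B11SectG` ∕ `B11Ineq189` ∕ `B11Ineq189Census`; nothing of the series is asserted here: every printed operator enters
through a majorant HYPOTHESIS of the printed shape and every pairing property is a displayed hypothesis; what is PROVED is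
[folklore] duality bookkeeping and the rate arithmetic of [3] (2.54) + Lemma 2.1.

WHY THIS FILE EXISTS (YM-DAG node N07 = [B11], -b₂ seat `pub-ymgap-dag-n21-b` g2, dag-lead [DAGLEAD-G2-REBALANCE-32] on
the owner's published cut `HOME/pub-ymgap-dag-n07-b/HANDOFF-g0.md` §«What the (189) ASSEMBLY at concrete letters still
needs»: *«NOT concrete (structural reasons): the TRANSPOSED families δ𝔇*, 𝔇*, H* of the SHAPE-B rows T1″∕T2.3″∕T2.4″∕
T3″∕T4.2″∕T5.B″ — a transpose needs a PAIRING on 𝔸-valued bond configurations (trace form) …; sup-size majorants do not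
transpose (row sums ≠ column sums) … typable once a pairing is fixed»*).  The census `B11Ineq189Census` (§3, rows
`termT1`, `termT23B`, `termT3B`, `termT42`) takes the transposed `δ𝔇`-family as a VARIABLE with a joint majorant «of
`d2D_hasMaj₂`'s shape … kernel bounds being orientation-free»; the tree's concrete letter is the PRIMAL family
(`B11Ineq189D2DDecayConcrete.hasMaj₂_d2_Dfix_concrete`: `HasMaj₂ (supSize fine) (supSize fine) (supSize coarse) δ𝔇
((2∕ε)θ_D·e^{−¼δ₀|y−y″|₁}·e^{−¼δ₀|y−y′|₁})`).  THIS FILE supplies the missing bookkeeping between the two, and records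
what it costs.

WHAT IS PROVED ([folklore] unless a row locator is given).
* §1 **TRANSPOSITION UNDER AN ADJOINT PAIR** (`hasMaj_transpose_of_adjoint`, `hasMaj₂_transpose_of_adjoint`): two
  pairings `p₁`, `p₂` (any real-valued functions of two arguments), an adjoint identity `p₂ (T μ) w = p₁ μ (Tᵗ w)`, the
  DUALITY of the block size `b₁` against `p₁` on localised test elements (constant `C`: «the size of `f` at `y` is at most
  `C ×` the best pairing of `f` with a unit element localised at `y`») and the block HÖLDER inequality of `p₂` against
  `b₂` (constant `N`: «an element `w` localised at `y` pairs with any `f` to at most `N·loc_y f·loc_y w`», `N` = block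
  cardinality × the dimension constant of the value pairing) ⇒ a majorant `K(y, y′)` of `T` is the majorant
  `C·N·K(y′, y)` of `Tᵗ` — OUTPUT AND INPUT BLOCKS SWAPPED; for an `𝔄`-dependent family `K(y, y″, y′) ↦ C·N·K(y″, y, y′)`.
  This is the precise content of «kernel bounds are orientation-free» ([3] p. 232, (2.51)): true for the KERNEL, false
  for the SHAPE — the transposed joint majorant decays from the CONTRACTED block `y″`, not from the output block `y`
  (`hasMaj₂_transpose_of_adjoint_exp`: `θ·e^{−ρd(y,y″)}·e^{−ρ′d(y,y′)} ↦ C·N·θ·e^{−ρd(y,y″)}·e^{−ρ′d(y″,y′)}`); for ONE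
  operator (`𝔇*`, `H*`: the SHAPE-L letters `Dst`, `Hst` of the census) the single exponential IS orientation-free
  (`hasMaj_transpose_of_adjoint_exp`: `a·e^{−ρd} ↦ C·N·a·e^{−ρd}`).
* §2 **CONTRACTION OF A CENTRED FAMILY** (`hasMaj_apply_bounded_centred`): a family of majorant
  `θ·e^{−ρd(y,y″)}·e^{−ρ′d(y″,y′)}` contracted against a FIXED configuration of local size `≤ M` in the `y″`-slot is an
  ordinary operator of majorant `κθMc·e^{−ρ₀d(y,y′)}` for every `ρ₀ ≤ ρ′` with `ρ₀ + σ ≤ ρ` (the convolution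
  `B11SectG.conv_exp_le` = [3] (2.54) + the row sum of Lemma 2.1 at rate `σ`); end-to-end from the primal family:
  `term189_of_d2D_transpose`.  THE LOCATED COST: the contracted slot spends the margin `σ` of the PRIMAL `μ`-rate — so
  from the tree's concrete split `(¼δ₀, ¼δ₀)` of (73)'s `½δ₀` a transposed SHAPE-B row books at rate `¼δ₀ − σ`
  (`term189_of_d2D_transpose_eighth`: rate `⅛δ₀`), and at (189)'s printed `¼δ₀` exactly it needs the primal letter at
  `(¼δ₀ + σ, ¼δ₀)`, i.e. (73) read at rate `½δ₀ + σ` (`term189_of_d2D_transpose_quarter` with `σ = ⅛δ₀`: primal rates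
  `(⅜δ₀, ¼δ₀)`).  Both `δ₀`'s are the free O(1) rate of Lemma 2.1 [3]: constants-ledger bookkeeping, recorded, not a gap.
* §3 **THE SHAPE-B ROWS FROM THE PRIMAL FAMILY** (`termT1_primal`, `termT23B_primal` (T2.3″ and T2.4″),
  `termT3B_primal`, `termT42_primal` (T4.2″ and T5.B″)): the census rows of `B11Ineq189Census` §3 with the hypothesis
  «transposed family of `d2D_hasMaj₂`'s shape» REPLACED by the primal family's majorant at rates `(⅜δ₀, ¼δ₀)` + the
  pairing letters; conclusions in the census currency `…·e^{−¼δ₀d(y,y′)}` with `RowSum g (δ₀∕8) c`, so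
  `B11Ineq189Census.ineq189_of_groups` consumes them unchanged.
* NON-VACUITY of the three pairing letters is the companion module `B11Ineq189TransposeScalar` (the SCALAR MODEL:
  real kernels between the sharp-block sup sizes of `B11SupSize190.supSize`, dot product, `C = 1`, `N = max_y #Δ(y)` —
  there the letters are THEOREMS and [3] (2.51) «transposed» holds with the block-cardinality cost displayed); the
  gauge-field instance (the trace form on `Matrix n n ℂ`-valued bond configurations) is the definition-lane companion.

HONEST SCOPE.  (1) MAJORANT-LEVEL bookkeeping over the abstract `B6.Geometry` ∕ `BlockNorm` carriers; the pairings, the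
adjoint identity, duality and Hölder are HYPOTHESES here (theorems in the scalar model of the companion module); the identification of
`Φ`∕`Φᵗ` with Bałaban's `δ𝔇(A′)[𝔄]` and its transpose is the consumer's (n07-b's concrete `hasMaj₂_d2_Dfix_concrete`
supplies `Φ`; `Φᵗ` exists by finite-dimensional linear algebra once the pairing is fixed).  (2) No symmetry of the primal
kernel is assumed; the symmetry `d(y,y′) = d(y′,y)` and the triangle inequality (2.54) of the block distance are displayed
hypotheses (`cubeGeometry`: `|y − y′|₁`).  (3) Nothing of (73), (85)–(96), (189) is asserted; no `def`, no `instance`, no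
`notation`; 0 sorry; axioms standard.  One finite T⁴ programme at fixed `ε` upstream — NOT infinite volume, NOT OS on ℝ⁴,
NOT a mass gap, NOT Clay.
-/

namespace Literature.MathematicalPhysics.QuantumFieldTheory.Balaban1983to89.B11Ineq189Transpose

open Finset B6RandomWalk B11SectG B11Ineq189 B11Ineq189Census

variable {g : B6.Geometry}
variable {FA F₀ F₁ F₂ F₃ : Type} [AddCommGroup FA] [Module ℝ FA] [AddCommGroup F₀] [Module ℝ F₀]
  [AddCommGroup F₁] [Module ℝ F₁] [AddCommGroup F₂] [Module ℝ F₂] [AddCommGroup F₃] [Module ℝ F₃]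

/-! ## §1  Transposition of a majorant under an adjoint pair -/

section Transpose

/-- **TRANSPOSITION OF A MAJORANT UNDER AN ADJOINT PAIR.**  Let `T : F₁ → F₂` have the majorant `K ≥ 0` between the
block sizes `b₁`, `b₂`, and let `Tᵗ : F₂ → F₁` be adjoint to it for two real pairings, `p₂ (Tμ) w = p₁ μ (Tᵗw)`.  If the
size `b₁` is DUAL to `p₁` on localised test elements with constant `C` («`loc_y f ≤ C·s` whenever every `μ` localised at
`y` of size `≤ 1` pairs with `f` to at most `s`») and `p₂` is HÖLDER against `b₂` with constant `N ≥ 0` («an element `w`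
localised at `y` pairs with any `f` to at most `N·loc_y f·loc_y w`»), then `Tᵗ` has the majorant `C·N·K(y′, y)` — the
kernel with OUTPUT AND INPUT BLOCKS SWAPPED ([3] (2.51): the kernel bound of an operator and of its transpose are the
same numbers; the two constants are the price of reading them in block SIZES). [cite: Balaban1984PropagatorsII, (2.51)–(2.53) p.232] -/
theorem hasMaj_transpose_of_adjoint {b₁ : BlockNorm g F₁} {b₂ : BlockNorm g F₂} {T : F₁ →ₗ[ℝ] F₂}
    {Tt : F₂ →ₗ[ℝ] F₁} {K : g.Site → g.Site → ℝ} {p₁ : F₁ → F₁ → ℝ} {p₂ : F₂ → F₂ → ℝ} {C N : ℝ}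
    (hN : 0 ≤ N) (hK : ∀ y y', 0 ≤ K y y')
    (hadj : ∀ μ w, p₂ (T μ) w = p₁ μ (Tt w))
    (hdual : ∀ (y : g.Site) (f : F₁) (s : ℝ),
      (∀ μ : F₁, b₁.IsLoc y μ → b₁.loc y μ ≤ 1 → p₁ μ f ≤ s) → b₁.loc y f ≤ C * s)
    (hpair : ∀ (y : g.Site) (w : F₂), b₂.IsLoc y w → ∀ f : F₂, p₂ f w ≤ N * (b₂.loc y f * b₂.loc y w))
    (h : HasMaj b₁ b₂ T K) :
    HasMaj b₂ b₁ Tt (fun y y' => C * N * K y' y) := by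
  intro y₃ w hw y₀
  have key : ∀ μ : F₁, b₁.IsLoc y₀ μ → b₁.loc y₀ μ ≤ 1 → p₁ μ (Tt w) ≤ N * K y₃ y₀ * b₂.loc y₃ w := by
    intro μ hμ hμ1
    rw [← hadj]
    have h1 : b₂.loc y₃ (T μ) ≤ K y₃ y₀ * b₁.loc y₀ μ := h y₀ μ hμ y₃
    have h2 : K y₃ y₀ * b₁.loc y₀ μ ≤ K y₃ y₀ := by
      calc K y₃ y₀ * b₁.loc y₀ μ ≤ K y₃ y₀ * 1 := mul_le_mul_of_nonneg_left hμ1 (hK _ _)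
        _ = K y₃ y₀ := mul_one _
    calc p₂ (T μ) w ≤ N * (b₂.loc y₃ (T μ) * b₂.loc y₃ w) := hpair y₃ w hw (T μ)
      _ ≤ N * (K y₃ y₀ * b₂.loc y₃ w) :=
          mul_le_mul_of_nonneg_left (mul_le_mul_of_nonneg_right (h1.trans h2) (b₂.loc_nonneg _ _)) hN
      _ = N * K y₃ y₀ * b₂.loc y₃ w := by ring
  calc b₁.loc y₀ (Tt w) ≤ C * (N * K y₃ y₀ * b₂.loc y₃ w) := hdual y₀ (Tt w) _ key
    _ = C * N * K y₃ y₀ * b₂.loc y₃ w := by ring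

/-- **TRANSPOSITION OF AN `𝔄`-DEPENDENT FAMILY** (the shape of `δ𝔇*[𝔄]`): if `Φ𝔄 : F₁ → F₂` has the joint majorant
`K(y, y″, y′) ≥ 0` (`μ` localised at `y″`, `𝔄` at `y′`) and `Φᵗ𝔄 : F₂ → F₁` is adjoint to `Φ𝔄` for every `𝔄`, then under
the duality of `b₁`∕`p₁` (constant `C`) and the Hölder inequality of `p₂`∕`b₂` (constant `N ≥ 0`) the transposed family
has the joint majorant `C·N·K(y″, y, y′)` — the output block and the contracted block SWAPPED, the `𝔄`-block kept.
[cite: Balaban1984PropagatorsII, (2.51)–(2.53) p.232] -/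
theorem hasMaj₂_transpose_of_adjoint {bA : BlockNorm g FA} {b₁ : BlockNorm g F₁} {b₂ : BlockNorm g F₂}
    {Φ : FA →ₗ[ℝ] F₁ →ₗ[ℝ] F₂} {Φt : FA →ₗ[ℝ] F₂ →ₗ[ℝ] F₁} {K : g.Site → g.Site → g.Site → ℝ}
    {p₁ : F₁ → F₁ → ℝ} {p₂ : F₂ → F₂ → ℝ} {C N : ℝ}
    (hN : 0 ≤ N) (hK : ∀ y y'' y', 0 ≤ K y y'' y')
    (hadj : ∀ v μ w, p₂ (Φ v μ) w = p₁ μ (Φt v w))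
    (hdual : ∀ (y : g.Site) (f : F₁) (s : ℝ),
      (∀ μ : F₁, b₁.IsLoc y μ → b₁.loc y μ ≤ 1 → p₁ μ f ≤ s) → b₁.loc y f ≤ C * s)
    (hpair : ∀ (y : g.Site) (w : F₂), b₂.IsLoc y w → ∀ f : F₂, p₂ f w ≤ N * (b₂.loc y f * b₂.loc y w))
    (h : HasMaj₂ bA b₁ b₂ Φ K) :
    HasMaj₂ bA b₂ b₁ Φt (fun y y'' y' => C * N * K y'' y y') := by
  intro y' v hv y₃ w hw y₀
  have key : ∀ μ : F₁, b₁.IsLoc y₀ μ → b₁.loc y₀ μ ≤ 1 →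
      p₁ μ (Φt v w) ≤ N * K y₃ y₀ y' * bA.loc y' v * b₂.loc y₃ w := by
    intro μ hμ hμ1
    rw [← hadj]
    have h1 : b₂.loc y₃ (Φ v μ) ≤ K y₃ y₀ y' * b₁.loc y₀ μ * bA.loc y' v := h y' v hv y₀ μ hμ y₃
    have h2 : K y₃ y₀ y' * b₁.loc y₀ μ * bA.loc y' v ≤ K y₃ y₀ y' * bA.loc y' v := by
      refine mul_le_mul_of_nonneg_right ?_ (bA.loc_nonneg _ _)
      calc K y₃ y₀ y' * b₁.loc y₀ μ ≤ K y₃ y₀ y' * 1 := mul_le_mul_of_nonneg_left hμ1 (hK _ _ _)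
        _ = K y₃ y₀ y' := mul_one _
    calc p₂ (Φ v μ) w ≤ N * (b₂.loc y₃ (Φ v μ) * b₂.loc y₃ w) := hpair y₃ w hw (Φ v μ)
      _ ≤ N * (K y₃ y₀ y' * bA.loc y' v * b₂.loc y₃ w) :=
          mul_le_mul_of_nonneg_left (mul_le_mul_of_nonneg_right (h1.trans h2) (b₂.loc_nonneg _ _)) hN
      _ = N * K y₃ y₀ y' * bA.loc y' v * b₂.loc y₃ w := by ring
  calc b₁.loc y₀ (Φt v w) ≤ C * (N * K y₃ y₀ y' * bA.loc y' v * b₂.loc y₃ w) := hdual y₀ (Φt v w) _ key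
    _ = C * N * K y₃ y₀ y' * b₂.loc y₃ w * bA.loc y' v := by ring

/-- **THE TRANSPOSED JOINT MAJORANT IS CENTRED AT THE CONTRACTED BLOCK.**  For a primal family of the (73)∕(189) shape
`θ·e^{−ρd(y,y″)}·e^{−ρ′d(y,y′)}` (decay from the OUTPUT block `y`), the transposed family has the majorant
`C·N·θ·e^{−ρd(y,y″)}·e^{−ρ′d(y″,y′)}` — decay from the CONTRACTED block `y″` (symmetric block distance).  «Kernel bounds are
orientation-free» holds for the numbers, not for the shape. [cite: Balaban1984PropagatorsII, (2.51)–(2.53) p.232] -/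
theorem hasMaj₂_transpose_of_adjoint_exp {bA : BlockNorm g FA} {b₁ : BlockNorm g F₁} {b₂ : BlockNorm g F₂}
    {Φ : FA →ₗ[ℝ] F₁ →ₗ[ℝ] F₂} {Φt : FA →ₗ[ℝ] F₂ →ₗ[ℝ] F₁} {p₁ : F₁ → F₁ → ℝ} {p₂ : F₂ → F₂ → ℝ}
    {C N θ ρ ρ' : ℝ} (hsymm : ∀ a b : g.Site, g.dist a b = g.dist b a) (hN : 0 ≤ N) (hθ : 0 ≤ θ)
    (hadj : ∀ v μ w, p₂ (Φ v μ) w = p₁ μ (Φt v w))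
    (hdual : ∀ (y : g.Site) (f : F₁) (s : ℝ),
      (∀ μ : F₁, b₁.IsLoc y μ → b₁.loc y μ ≤ 1 → p₁ μ f ≤ s) → b₁.loc y f ≤ C * s)
    (hpair : ∀ (y : g.Site) (w : F₂), b₂.IsLoc y w → ∀ f : F₂, p₂ f w ≤ N * (b₂.loc y f * b₂.loc y w))
    (h : HasMaj₂ bA b₁ b₂ Φ
      (fun y y'' y' => θ * Real.exp (-(ρ * g.dist y y'')) * Real.exp (-(ρ' * g.dist y y')))) :
    HasMaj₂ bA b₂ b₁ Φt (fun y y'' y' =>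
      C * N * θ * Real.exp (-(ρ * g.dist y y'')) * Real.exp (-(ρ' * g.dist y'' y'))) := by
  refine (hasMaj₂_transpose_of_adjoint hN (fun y y'' y' => ?_) hadj hdual hpair h).mono fun y y'' y' => ?_
  · exact mul_nonneg (mul_nonneg hθ (Real.exp_nonneg _)) (Real.exp_nonneg _)
  · rw [hsymm y'' y]
    exact le_of_eq (by ring)

/-- **FOR ONE OPERATOR THE SHAPE IS ORIENTATION-FREE** (the letters `𝔇*` of (88)–(90) and `H*` of (90)–(96), SHAPE-L
factors `Dst`, `Hst` of the census): a single operator of majorant `a·e^{−ρd(y,y′)}` ((73) for `𝔇` at `½δ₀`, (46) ∕ [5]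
Thm 3.12 for `H`) has the transposed majorant `C·N·a·e^{−ρd(y,y′)}` — the SAME exponential (symmetric block distance), only
the duality and Hölder constants appear.  The asymmetry of §2 is a phenomenon of the JOINT (two-slot) majorants only.
[cite: Balaban1985Variational, (73) p.289 + (88)–(90) p.291; Balaban1984PropagatorsII, (2.51) p.232] -/
theorem hasMaj_transpose_of_adjoint_exp {b₁ : BlockNorm g F₁} {b₂ : BlockNorm g F₂} {T : F₁ →ₗ[ℝ] F₂}
    {Tt : F₂ →ₗ[ℝ] F₁} {p₁ : F₁ → F₁ → ℝ} {p₂ : F₂ → F₂ → ℝ} {C N a ρ : ℝ}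
    (hsymm : ∀ x y : g.Site, g.dist x y = g.dist y x) (hN : 0 ≤ N) (ha : 0 ≤ a)
    (hadj : ∀ μ w, p₂ (T μ) w = p₁ μ (Tt w))
    (hdual : ∀ (y : g.Site) (f : F₁) (s : ℝ),
      (∀ μ : F₁, b₁.IsLoc y μ → b₁.loc y μ ≤ 1 → p₁ μ f ≤ s) → b₁.loc y f ≤ C * s)
    (hpair : ∀ (y : g.Site) (w : F₂), b₂.IsLoc y w → ∀ f : F₂, p₂ f w ≤ N * (b₂.loc y f * b₂.loc y w))
    (h : HasMaj b₁ b₂ T (fun y y' => a * Real.exp (-(ρ * g.dist y y')))) :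
    HasMaj b₂ b₁ Tt (fun y y' => C * N * a * Real.exp (-(ρ * g.dist y y'))) := by
  refine (hasMaj_transpose_of_adjoint hN (fun y y' => mul_nonneg ha (Real.exp_nonneg _)) hadj hdual hpair h).mono
    fun y y' => ?_
  rw [hsymm y' y]
  exact le_of_eq (by ring)

end Transpose

/-! ## §2  Contraction of a centred family against a fixed bounded configuration, and the located rate cost -/

section Centred

/-- **CONTRACTION OF A CENTRED FAMILY.**  If the family `T𝔄 : F₂ → F₁` has the joint majorant
`θ·e^{−ρd(y,y″)}·e^{−ρ′d(y″,y′)}` (decay from the CONTRACTED block `y″` — the transposed shape of §1) and `X ∈ F₂` is a FIXED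
configuration of local size `≤ M` everywhere, then `𝔄 ↦ T𝔄X` has the ordinary majorant `κ₂θMc·e^{−ρ₀d(y,y′)}` for every
`ρ₀ ≥ 0` with `ρ₀ ≤ ρ′` and `ρ₀ + σ ≤ ρ`: the partition of unity of the `X`-space ([3] (2.52)), the triangle inequality
(2.54) through `y″`, and the row sum of Lemma 2.1 at rate `σ` (`B11SectG.conv_exp_le`).  The margin `σ` is taken from the
`μ`-rate `ρ` of the PRIMAL family. [cite: Balaban1984PropagatorsII, (2.52)–(2.54) pp.232–233 + Lemma 2.1 p.234] -/
theorem hasMaj_apply_bounded_centred {bA : BlockNorm g FA} {b₁ : BlockNorm g F₁} {b₂ : BlockNorm g F₂}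
    {T : FA →ₗ[ℝ] F₂ →ₗ[ℝ] F₁} {X : F₂} {W : FA →ₗ[ℝ] F₁} {M θ ρ ρ' ρ₀ σ c : ℝ}
    (htri : Triangle254 g) (hd : ∀ a b : g.Site, 0 ≤ g.dist a b) (hrow : RowSum g σ c) (hθ : 0 ≤ θ)
    (hM : 0 ≤ M) (hρ₀ : 0 ≤ ρ₀) (h1 : ρ₀ ≤ ρ') (h2 : ρ₀ + σ ≤ ρ)
    (h : HasMaj₂ bA b₂ b₁ T
      (fun y y'' y' => θ * Real.exp (-(ρ * g.dist y y'')) * Real.exp (-(ρ' * g.dist y'' y'))))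
    (hX : ∀ y'', b₂.loc y'' X ≤ M) (hW : ∀ v, W v = T v X) :
    HasMaj bA b₁ W (fun y y' => b₂.κ * θ * M * c * Real.exp (-(ρ₀ * g.dist y y'))) := by
  refine (h.apply_bounded (fun y y'' y' => mul_nonneg (mul_nonneg hθ (Real.exp_nonneg _)) (Real.exp_nonneg _))
    hX hW).mono fun y y' => ?_
  have hconv := conv_exp_le htri hd hrow hρ₀ h1 h2 y y'
  have hnn : 0 ≤ b₂.κ * θ * M := mul_nonneg (mul_nonneg b₂.κ_nonneg hθ) hM
  calc ∑ y'' : g.Site, θ * Real.exp (-(ρ * g.dist y y'')) * Real.exp (-(ρ' * g.dist y'' y')) * (b₂.κ * M)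
      = b₂.κ * θ * M *
          ∑ y'' : g.Site, Real.exp (-(ρ * g.dist y y'')) * Real.exp (-(ρ' * g.dist y'' y')) := by
        rw [Finset.mul_sum]
        exact Finset.sum_congr rfl fun y'' _ => by ring
    _ ≤ b₂.κ * θ * M * (c * Real.exp (-(ρ₀ * g.dist y y'))) := mul_le_mul_of_nonneg_left hconv hnn
    _ = b₂.κ * θ * M * c * Real.exp (-(ρ₀ * g.dist y y')) := by ring

variable {bN : BlockNorm g FA} {b₀ : BlockNorm g F₀} {b₃ : BlockNorm g F₃}

/-- **A TRANSPOSED SHAPE-B ROW FROM THE PRIMAL `δ𝔇`-FAMILY — GENERAL RATES.**  Primal family `Φ𝔄 : F₀ → F₃` with the joint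
majorant `θ·e^{−ρd(y,y″)}·e^{−ρ′d(y,y′)}` (the tree's concrete letter has `(ρ, ρ′) = (¼δ₀, ¼δ₀)`), its transpose `Φᵗ𝔄 : F₃ → F₀`
under the pairings `p₀`, `p₃` (adjoint identity, duality of `b₀`∕`p₀` with `C ≥ 0`, Hölder of `p₃`∕`b₃` with `N ≥ 0`), a FIXED
configuration `X ∈ F₃` of local size `≤ M`: the operator `𝔄 ↦ Φᵗ𝔄X` has the majorant `κ₃·(C·N·θ)·M·c·e^{−ρ₀d(y,y′)}` for every
`ρ₀ ≥ 0` with `ρ₀ ≤ ρ′`, `ρ₀ + σ ≤ ρ` (`RowSum g σ c`).  THE RATE COST IS LOCATED HERE: the contracted slot pays the margin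
`σ` out of the primal `μ`-rate `ρ`. [cite: Balaban1985Variational, (189) p.308; Balaban1984PropagatorsII, (2.51)–(2.54) pp.232–233] -/
theorem term189_of_d2D_transpose {Φ : FA →ₗ[ℝ] F₀ →ₗ[ℝ] F₃} {Φt : FA →ₗ[ℝ] F₃ →ₗ[ℝ] F₀}
    {p₀ : F₀ → F₀ → ℝ} {p₃ : F₃ → F₃ → ℝ} {X : F₃} {W : FA →ₗ[ℝ] F₀} {C N θ ρ ρ' ρ₀ σ c M : ℝ}
    (htri : Triangle254 g) (hd : ∀ a b : g.Site, 0 ≤ g.dist a b) (hsymm : ∀ a b : g.Site, g.dist a b = g.dist b a)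
    (hrow : RowSum g σ c) (hC : 0 ≤ C) (hN : 0 ≤ N) (hθ : 0 ≤ θ) (hM : 0 ≤ M) (hρ₀ : 0 ≤ ρ₀) (h1 : ρ₀ ≤ ρ')
    (h2 : ρ₀ + σ ≤ ρ)
    (hadj : ∀ v μ w, p₃ (Φ v μ) w = p₀ μ (Φt v w))
    (hdual : ∀ (y : g.Site) (f : F₀) (s : ℝ),
      (∀ μ : F₀, b₀.IsLoc y μ → b₀.loc y μ ≤ 1 → p₀ μ f ≤ s) → b₀.loc y f ≤ C * s)
    (hpair : ∀ (y : g.Site) (w : F₃), b₃.IsLoc y w → ∀ f : F₃, p₃ f w ≤ N * (b₃.loc y f * b₃.loc y w))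
    (hΦ : HasMaj₂ bN b₀ b₃ Φ
      (fun y y'' y' => θ * Real.exp (-(ρ * g.dist y y'')) * Real.exp (-(ρ' * g.dist y y'))))
    (hX : ∀ y, b₃.loc y X ≤ M) (hW : ∀ v, W v = Φt v X) :
    HasMaj bN b₀ W (fun y y' => b₃.κ * (C * N * θ) * M * c * Real.exp (-(ρ₀ * g.dist y y'))) :=
  hasMaj_apply_bounded_centred htri hd hrow (mul_nonneg (mul_nonneg hC hN) hθ) hM hρ₀ h1 h2
    (hasMaj₂_transpose_of_adjoint_exp hsymm hN hθ hadj hdual hpair hΦ) hX hW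

/-- **… AT (189)'s PRINTED RATE `¼δ₀`** (census currency `RowSum g (δ₀∕8) c`): the transposed row books at `e^{−¼δ₀d(y,y′)}`
provided the primal family is read at the rates `(⅜δ₀, ¼δ₀)` — `μ`-rate `ρ ≥ ¼δ₀ + ⅛δ₀`, `𝔄`-rate `ρ′ ≥ ¼δ₀` — i.e. (73) at
`½δ₀ + ⅛δ₀` before the geometric-mean split (constants-ledger bookkeeping on the free rate of Lemma 2.1 [3]).
[cite: Balaban1985Variational, (189) p.308 + (73) p.289; Balaban1984PropagatorsII, Lemma 2.1 p.234] -/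
theorem term189_of_d2D_transpose_quarter {Φ : FA →ₗ[ℝ] F₀ →ₗ[ℝ] F₃} {Φt : FA →ₗ[ℝ] F₃ →ₗ[ℝ] F₀}
    {p₀ : F₀ → F₀ → ℝ} {p₃ : F₃ → F₃ → ℝ} {X : F₃} {W : FA →ₗ[ℝ] F₀} {C N θ ρ ρ' δ₀ c M : ℝ}
    (htri : Triangle254 g) (hd : ∀ a b : g.Site, 0 ≤ g.dist a b) (hsymm : ∀ a b : g.Site, g.dist a b = g.dist b a)
    (hrow : RowSum g (δ₀ / 8) c) (hδ₀ : 0 ≤ δ₀) (hC : 0 ≤ C) (hN : 0 ≤ N) (hθ : 0 ≤ θ) (hM : 0 ≤ M)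
    (h1 : δ₀ / 4 ≤ ρ') (h2 : δ₀ / 4 + δ₀ / 8 ≤ ρ)
    (hadj : ∀ v μ w, p₃ (Φ v μ) w = p₀ μ (Φt v w))
    (hdual : ∀ (y : g.Site) (f : F₀) (s : ℝ),
      (∀ μ : F₀, b₀.IsLoc y μ → b₀.loc y μ ≤ 1 → p₀ μ f ≤ s) → b₀.loc y f ≤ C * s)
    (hpair : ∀ (y : g.Site) (w : F₃), b₃.IsLoc y w → ∀ f : F₃, p₃ f w ≤ N * (b₃.loc y f * b₃.loc y w))
    (hΦ : HasMaj₂ bN b₀ b₃ Φ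
      (fun y y'' y' => θ * Real.exp (-(ρ * g.dist y y'')) * Real.exp (-(ρ' * g.dist y y'))))
    (hX : ∀ y, b₃.loc y X ≤ M) (hW : ∀ v, W v = Φt v X) :
    HasMaj bN b₀ W (fun y y' => b₃.κ * (C * N * θ) * M * c * Real.exp (-(δ₀ / 4 * g.dist y y'))) :=
  term189_of_d2D_transpose htri hd hsymm hrow hC hN hθ hM (by positivity) h1 h2 hadj hdual hpair hΦ hX hW

/-- **… FROM THE TREE'S CONCRETE SPLIT `(¼δ₀, ¼δ₀)`** (`B11Ineq189D2DDecayConcrete.hasMaj₂_d2_Dfix_concrete`'s rates): the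
transposed row then books at rate `⅛δ₀` — the honest reading of «orientation-free» at the level of SHAPES (the `μ`-margin
`⅛δ₀` is spent on the row sum through the contracted block). [cite: Balaban1985Variational, (189) p.308 + (73) p.289; Balaban1984PropagatorsII, Lemma 2.1 p.234] -/
theorem term189_of_d2D_transpose_eighth {Φ : FA →ₗ[ℝ] F₀ →ₗ[ℝ] F₃} {Φt : FA →ₗ[ℝ] F₃ →ₗ[ℝ] F₀}
    {p₀ : F₀ → F₀ → ℝ} {p₃ : F₃ → F₃ → ℝ} {X : F₃} {W : FA →ₗ[ℝ] F₀} {C N θ δ₀ c M : ℝ}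
    (htri : Triangle254 g) (hd : ∀ a b : g.Site, 0 ≤ g.dist a b) (hsymm : ∀ a b : g.Site, g.dist a b = g.dist b a)
    (hrow : RowSum g (δ₀ / 8) c) (hδ₀ : 0 ≤ δ₀) (hC : 0 ≤ C) (hN : 0 ≤ N) (hθ : 0 ≤ θ) (hM : 0 ≤ M)
    (hadj : ∀ v μ w, p₃ (Φ v μ) w = p₀ μ (Φt v w))
    (hdual : ∀ (y : g.Site) (f : F₀) (s : ℝ),
      (∀ μ : F₀, b₀.IsLoc y μ → b₀.loc y μ ≤ 1 → p₀ μ f ≤ s) → b₀.loc y f ≤ C * s)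
    (hpair : ∀ (y : g.Site) (w : F₃), b₃.IsLoc y w → ∀ f : F₃, p₃ f w ≤ N * (b₃.loc y f * b₃.loc y w))
    (hΦ : HasMaj₂ bN b₀ b₃ Φ
      (fun y y'' y' => θ * Real.exp (-(δ₀ / 4 * g.dist y y'')) * Real.exp (-(δ₀ / 4 * g.dist y y'))))
    (hX : ∀ y, b₃.loc y X ≤ M) (hW : ∀ v, W v = Φt v X) :
    HasMaj bN b₀ W (fun y y' => b₃.κ * (C * N * θ) * M * c * Real.exp (-(δ₀ / 8 * g.dist y y'))) :=
  term189_of_d2D_transpose htri hd hsymm hrow hC hN hθ hM (by positivity) (by linarith) (by linarith) hadj hdual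
    hpair hΦ hX hW

end Centred

/-! ## §3  The SHAPE-B rows of the census from the PRIMAL family (census currency: rate `¼δ₀`, `RowSum g (δ₀∕8) c`) -/

section ShapeBPrimal

variable {bN : BlockNorm g FA} {b₀ : BlockNorm g F₀} {b₁ : BlockNorm g F₁} {b₃ : BlockNorm g F₃} {δ₀ c : ℝ}

/-- **T1″ (from (85)) FROM THE PRIMAL FAMILY: `−(δ𝔇₂[𝔄])*·h`**, `h = ⟨HᵀJ⟩` FIXED of local size `≤ M_h` (the first two lines
of (86)).  In `B11Ineq189Census.termT1` the transposed `δ𝔇₂`-family is a variable with a joint majorant of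
`d2D_hasMaj₂`'s shape; here it is PRODUCED from the primal family (`d2D2_hasMaj₂` ∕ the concrete `hasMaj₂_d2D2_Dfix_concrete`,
read at rates `(⅜δ₀, ¼δ₀)`) and the pairing letters: constant `κ₃·(C·N·θ)·M_h·c`, rate `¼δ₀`.
[cite: Balaban1985Variational, (85)–(86) p.291 + (189) p.308] -/
theorem termT1_primal {Φ : FA →ₗ[ℝ] F₀ →ₗ[ℝ] F₃} {Φt : FA →ₗ[ℝ] F₃ →ₗ[ℝ] F₀} {p₀ : F₀ → F₀ → ℝ}
    {p₃ : F₃ → F₃ → ℝ} {h : F₃} {W : FA →ₗ[ℝ] F₀} {C N θ ρ ρ' Mh : ℝ}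
    (htri : Triangle254 g) (hd : ∀ x y : g.Site, 0 ≤ g.dist x y) (hsymm : ∀ x y : g.Site, g.dist x y = g.dist y x)
    (hrow : RowSum g (δ₀ / 8) c) (hδ₀ : 0 ≤ δ₀) (hC : 0 ≤ C) (hN : 0 ≤ N) (hθ : 0 ≤ θ) (hMh : 0 ≤ Mh)
    (h1 : δ₀ / 4 ≤ ρ') (h2 : δ₀ / 4 + δ₀ / 8 ≤ ρ)
    (hadj : ∀ v μ w, p₃ (Φ v μ) w = p₀ μ (Φt v w))
    (hdual : ∀ (y : g.Site) (f : F₀) (s : ℝ),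
      (∀ μ : F₀, b₀.IsLoc y μ → b₀.loc y μ ≤ 1 → p₀ μ f ≤ s) → b₀.loc y f ≤ C * s)
    (hpair : ∀ (y : g.Site) (w : F₃), b₃.IsLoc y w → ∀ f : F₃, p₃ f w ≤ N * (b₃.loc y f * b₃.loc y w))
    (hΦ : HasMaj₂ bN b₀ b₃ Φ
      (fun y y'' y' => θ * Real.exp (-(ρ * g.dist y y'')) * Real.exp (-(ρ' * g.dist y y'))))
    (hh : ∀ y, b₃.loc y h ≤ Mh) (hW : ∀ v, W v = Φt v h) :
    HasMaj bN b₀ W (fun y y' => b₃.κ * (C * N * θ) * Mh * c * Real.exp (-(δ₀ / 4 * g.dist y y'))) :=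
  term189_of_d2D_transpose_quarter htri hd hsymm hrow hδ₀ hC hN hθ hMh h1 h2 hadj hdual hpair hΦ hh hW

/-- **T2.3″ ∕ T2.4″ first pieces (from (88)) FROM THE PRIMAL FAMILY: `δ𝔇*[𝔄]·X`, `X = S(X₀)` FIXED**, `S` =
`(L^jη)⁻¹(QGQ*)⁻¹` (majorant `a_S·e^{−ρ_Sd}`, `ρ_S ≥ ⅛δ₀`, [5] (3.132)) or `(L^jη)⁻¹a`, `X₀ = QA′` of local size `≤ M₀` ((77)):
`|X| ≤ a_S·κ₁·M₀·c` by `B11Ineq189Census.loc_apply_le`, then §2: constant `κ₃·(C·N·θ)·(a_Sκ₁M₀c)·c`, rate `¼δ₀`.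
[cite: Balaban1985Variational, (88) p.291 + (189) p.308; Balaban1985BackgroundPropagators, (3.132) p.422] -/
theorem termT23B_primal {Φ : FA →ₗ[ℝ] F₀ →ₗ[ℝ] F₃} {Φt : FA →ₗ[ℝ] F₃ →ₗ[ℝ] F₀} {p₀ : F₀ → F₀ → ℝ}
    {p₃ : F₃ → F₃ → ℝ} {S : F₁ →ₗ[ℝ] F₃} {X₀ : F₁} {W : FA →ₗ[ℝ] F₀} {C N θ ρ ρ' aS ρS M₀ : ℝ}
    (htri : Triangle254 g) (hd : ∀ x y : g.Site, 0 ≤ g.dist x y) (hsymm : ∀ x y : g.Site, g.dist x y = g.dist y x)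
    (hrow : RowSum g (δ₀ / 8) c) (hc : 0 ≤ c) (hδ₀ : 0 ≤ δ₀) (hC : 0 ≤ C) (hN : 0 ≤ N) (hθ : 0 ≤ θ) (haS : 0 ≤ aS)
    (hM₀ : 0 ≤ M₀) (hρS : δ₀ / 8 ≤ ρS) (h1 : δ₀ / 4 ≤ ρ') (h2 : δ₀ / 4 + δ₀ / 8 ≤ ρ)
    (hadj : ∀ v μ w, p₃ (Φ v μ) w = p₀ μ (Φt v w))
    (hdual : ∀ (y : g.Site) (f : F₀) (s : ℝ),
      (∀ μ : F₀, b₀.IsLoc y μ → b₀.loc y μ ≤ 1 → p₀ μ f ≤ s) → b₀.loc y f ≤ C * s)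
    (hpair : ∀ (y : g.Site) (w : F₃), b₃.IsLoc y w → ∀ f : F₃, p₃ f w ≤ N * (b₃.loc y f * b₃.loc y w))
    (hΦ : HasMaj₂ bN b₀ b₃ Φ
      (fun y y'' y' => θ * Real.exp (-(ρ * g.dist y y'')) * Real.exp (-(ρ' * g.dist y y'))))
    (hS : HasMaj b₁ b₃ S (fun y y' => aS * Real.exp (-(ρS * g.dist y y'))))
    (hX₀ : ∀ y, b₁.loc y X₀ ≤ M₀) (hW : ∀ v, W v = Φt v (S X₀)) :
    HasMaj bN b₀ W (fun y y' =>
      b₃.κ * (C * N * θ) * (aS * b₁.κ * M₀ * c) * c * Real.exp (-(δ₀ / 4 * g.dist y y'))) := by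
  have hκ₁ := b₁.κ_nonneg
  have hX : ∀ y, b₃.loc y (S X₀) ≤ aS * b₁.κ * M₀ * c := loc_apply_le hd hrow haS hM₀ hρS hS hX₀
  exact term189_of_d2D_transpose_quarter htri hd hsymm hrow hδ₀ hC hN hθ (by positivity) h1 h2 hadj hdual hpair hΦ
    hX hW

/-- **T3″ first piece (from (89)) FROM THE PRIMAL FAMILY: `δ𝔇*[𝔄]·(K₃D(A′))`** — `D(A′)` FIXED of local size `≤ M_D` ((55)),
`K₃` of majorant `a_K·e^{−ρ_Kd}` (`ρ_K ≥ ⅛δ₀`): the bookkeeping of `termT23B_primal`; rate `¼δ₀`.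
[cite: Balaban1985Variational, (55) p.287 + (89) p.291 + (189) p.308] -/
theorem termT3B_primal {Φ : FA →ₗ[ℝ] F₀ →ₗ[ℝ] F₃} {Φt : FA →ₗ[ℝ] F₃ →ₗ[ℝ] F₀} {p₀ : F₀ → F₀ → ℝ}
    {p₃ : F₃ → F₃ → ℝ} {K₃ : F₁ →ₗ[ℝ] F₃} {DA : F₁} {W : FA →ₗ[ℝ] F₀} {C N θ ρ ρ' aK ρK MD : ℝ}
    (htri : Triangle254 g) (hd : ∀ x y : g.Site, 0 ≤ g.dist x y) (hsymm : ∀ x y : g.Site, g.dist x y = g.dist y x)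
    (hrow : RowSum g (δ₀ / 8) c) (hc : 0 ≤ c) (hδ₀ : 0 ≤ δ₀) (hC : 0 ≤ C) (hN : 0 ≤ N) (hθ : 0 ≤ θ) (haK : 0 ≤ aK)
    (hMD : 0 ≤ MD) (hρK : δ₀ / 8 ≤ ρK) (h1 : δ₀ / 4 ≤ ρ') (h2 : δ₀ / 4 + δ₀ / 8 ≤ ρ)
    (hadj : ∀ v μ w, p₃ (Φ v μ) w = p₀ μ (Φt v w))
    (hdual : ∀ (y : g.Site) (f : F₀) (s : ℝ),
      (∀ μ : F₀, b₀.IsLoc y μ → b₀.loc y μ ≤ 1 → p₀ μ f ≤ s) → b₀.loc y f ≤ C * s)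
    (hpair : ∀ (y : g.Site) (w : F₃), b₃.IsLoc y w → ∀ f : F₃, p₃ f w ≤ N * (b₃.loc y f * b₃.loc y w))
    (hΦ : HasMaj₂ bN b₀ b₃ Φ
      (fun y y'' y' => θ * Real.exp (-(ρ * g.dist y y'')) * Real.exp (-(ρ' * g.dist y y'))))
    (hK : HasMaj b₁ b₃ K₃ (fun y y' => aK * Real.exp (-(ρK * g.dist y y'))))
    (hDA : ∀ y, b₁.loc y DA ≤ MD) (hW : ∀ v, W v = Φt v (K₃ DA)) :
    HasMaj bN b₀ W (fun y y' =>
      b₃.κ * (C * N * θ) * (aK * b₁.κ * MD * c) * c * Real.exp (-(δ₀ / 4 * g.dist y y'))) :=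
  termT23B_primal htri hd hsymm hrow hc hδ₀ hC hN hθ haK hMD hρK h1 h2 hadj hdual hpair hΦ hK hDA hW

/-- **T4.2″ (from (90)) and T5.B″ (from (91)–(96)) FROM THE PRIMAL FAMILY: `−δ𝔇*[𝔄]·(H*w)`** — `w` FIXED of local size
`≤ M_w` (the first line of (90), or the first derivatives `q_α` of the commutator polynomials (92)–(96)) pushed through `H*`
(majorant `B₀·e^{−δ_Hd}`, `δ_H ≥ ⅛δ₀`; the transpose of (46) ∕ [5] Thm 3.12's `H` — itself an instance of §1 once the pairing is
fixed), then contracted with the transposed family PRODUCED from the primal one: constant `κ₃·(C·N·θ)·(B₀κ₁M_wc)·c`, rate `¼δ₀`.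
[cite: Balaban1985Variational, (90)–(96) pp.291–292 + (189) p.308] -/
theorem termT42_primal {Φ : FA →ₗ[ℝ] F₀ →ₗ[ℝ] F₃} {Φt : FA →ₗ[ℝ] F₃ →ₗ[ℝ] F₀} {p₀ : F₀ → F₀ → ℝ}
    {p₃ : F₃ → F₃ → ℝ} {Hst : F₁ →ₗ[ℝ] F₃} {w : F₁} {W : FA →ₗ[ℝ] F₀} {C N θ ρ ρ' B₀ δH Mw : ℝ}
    (htri : Triangle254 g) (hd : ∀ x y : g.Site, 0 ≤ g.dist x y) (hsymm : ∀ x y : g.Site, g.dist x y = g.dist y x)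
    (hrow : RowSum g (δ₀ / 8) c) (hc : 0 ≤ c) (hδ₀ : 0 ≤ δ₀) (hC : 0 ≤ C) (hN : 0 ≤ N) (hθ : 0 ≤ θ) (hB₀ : 0 ≤ B₀)
    (hMw : 0 ≤ Mw) (hδH : δ₀ / 8 ≤ δH) (h1 : δ₀ / 4 ≤ ρ') (h2 : δ₀ / 4 + δ₀ / 8 ≤ ρ)
    (hadj : ∀ v μ w', p₃ (Φ v μ) w' = p₀ μ (Φt v w'))
    (hdual : ∀ (y : g.Site) (f : F₀) (s : ℝ),
      (∀ μ : F₀, b₀.IsLoc y μ → b₀.loc y μ ≤ 1 → p₀ μ f ≤ s) → b₀.loc y f ≤ C * s)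
    (hpair : ∀ (y : g.Site) (w' : F₃), b₃.IsLoc y w' → ∀ f : F₃, p₃ f w' ≤ N * (b₃.loc y f * b₃.loc y w'))
    (hΦ : HasMaj₂ bN b₀ b₃ Φ
      (fun y y'' y' => θ * Real.exp (-(ρ * g.dist y y'')) * Real.exp (-(ρ' * g.dist y y'))))
    (hH : HasMaj b₁ b₃ Hst (fun y y' => B₀ * Real.exp (-(δH * g.dist y y'))))
    (hw : ∀ y, b₁.loc y w ≤ Mw) (hW : ∀ v, W v = Φt v (Hst w)) :
    HasMaj bN b₀ W (fun y y' =>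
      b₃.κ * (C * N * θ) * (B₀ * b₁.κ * Mw * c) * c * Real.exp (-(δ₀ / 4 * g.dist y y'))) :=
  termT23B_primal htri hd hsymm hrow hc hδ₀ hC hN hθ hB₀ hMw hδH h1 h2 hadj hdual hpair hΦ hH hw hW

end ShapeBPrimal

end Literature.MathematicalPhysics.QuantumFieldTheory.Balaban1983to89.B11Ineq189Transpose
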